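import Mathlib.Analysis.Convex.Combination
import Mathlib.Analysis.Convex.Function
import Mathlib.Algebra.Order.Archimedean.Real.Basic
import Mathlib.Tactic.Positivity
import Mathlib.Tactic.FieldSimp
import Mathlib.Data.Real.Basic
import Mathlib.Tactic.Linarith
import Mathlib.Order.Interval.Set.Pi
import Mathlib.LinearAlgebra.AffineSpace.AffineMap
import HarnessLib

/-!
# Weak-duality certificates over a parameter box with multipliers SHARED on the varying constraints only
# (Bertsekas, *Nonlinear Programming*, Prop. 5.1.3, pointwise form; box = convex hull of its vertices)

Topic `Literature/Computation/Certificates` (joins `LagrangianSplitBound.lean` — weak duality and the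
dual-decomposition split bound — and `LinearProgramming.lean`: kernel-checkable certificate
arithmetic). Written for the Hubbard re-charter's fast layer (crew hubbard-fast: planner-p1
BOX2-SPEC.md §5(ii) `sharing: theta-rows` bundles; statements and names are VERBATIM those of the
planner's checked sketch `HOME/hubbard-fast-p1/lean/SharedVaryingBox.lean`, sha256 25fabff4…, moved
under `Literature/` so that both the engine's Summits-side `Transport/FixedDualBoxCertificate.lean`
(one FIXED dual for the whole box) and the Rows files can import it). Everything is PROVED; no
definition, no named fact, no number.

Source. D. P. Bertsekas, *Nonlinear Programming*, 2nd ed., Athena Scientific 1999, §5.1.2,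
**Proposition 5.1.3 (Weak Duality Theorem)**, whose printed proof is the pointwise statement "for all
`μ ≥ 0` and `x ∈ X` with `g(x) ≤ 0`: `q(μ) = inf_{z∈X} L(z,μ) ≤ f(x) + Σⱼ μⱼ gⱼ(x) ≤ f(x)`"
[Bertsekas1999NonlinearProgramming]; here the penalties `μⱼ(-gⱼ)` are abstracted into arbitrary
real-valued PENALTY functionals that are `≥ 0` on feasible points, and the Lagrangian lower bound
`q(μ) ≤ L(z, μ)` on the a-priori domain is the hypothesis a verifier certifies exactly.

Setting (the `sharing: theta-rows` rule). A family of programs indexed by a parameter `θ` in a real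
vector space `E`; primal points `y : Y` (e.g. moment vectors), an a-priori domain `D ⊆ Y` (variable
bounds) and the feasible set `F θ ⊆ Y` of the program at `θ`. At each vertex `v` of a parameter cell a
dual certificate is given whose multipliers on the `θ`-DEPENDENT ("varying") constraints are COMMON
to all vertices — they enter through penalties `ψ r y : E →ᵃ[ℝ] ℝ`, AFFINE in `θ` for fixed `y`
(shared multiplier × affinely parametrised row / PSD block) — while the multipliers on
`θ`-INDEPENDENT ("constant") constraints are FREE per vertex (penalties `φ v r y : ℝ`); the objective
value `c y : E →ᵃ[ℝ] ℝ` is affine in `θ`. The vertex check is `m ≤ c y v - Σ_r ψ r y v - Σ_r φ v r y`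
for ALL `y ∈ D` (a Lagrangian lower bound on the a-priori domain; for conic programs with a-priori
bounds this is what the `-Σⱼ Bⱼ|residualⱼ|` evaluation certifies). No concavity is used: the
certificate AT an interior point is exhibited as (shared parts kept, free parts averaged with the
barycentric weights), and weak duality is applied there.

* `sum_mul_le_of_sharedVarying_kernel` — pure bookkeeping, no parameter space: objective and shared
  penalties at the barycentre are the `w`-averages of their vertex values, all penalties are `≥ 0`
  on the barycentre's feasible set, vertex Lagrangian bounds `β k` on `D`
  ⇒ every `y ∈ F ∩ D` has objective `≥ Σ_k w_k β_k`;
* `sum_mul_le_of_sharedVarying` — the same at an affine combination `Σ w_k • v_k` (`Σ w = 1`, `w ≥ 0`)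
  of vertices, affinity supplying the averaging identities (`affineMap_apply_sum_smul`);
* `le_of_forall_boxVertices_sharedVarying` — BOX FORM: vertex certificates at the `2^|κ|` corners of
  `Set.Icc lo hi ⊆ (κ → ℝ)`, each certifying `m`, certify `m ≤ c y θ` for every `θ` in the box and
  every `y ∈ F θ ∩ D` (a coordinate box lies in the convex hull of its vertices — Mathlib's
  `convexHull_pi` and `segment_eq_Icc'`, inlined; as a named lemma it is the engine's Summits-side
  `…Transport.BoxCertificate.Icc_subset_convexHull_boxVertices`);
* `le_of_forall_boxVertices_shared` — the fixed-dual special case (no free penalties).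
* (`n`-extent cells) `le_of_forall_boxVertices_sharedVarying_nChord` — `θ`-box × `n`-chord.
* (gap test, last section) `sup'_le_sup'_of_gapTest` / `sup'_eq_of_gapTest` and the minimisation mirrors
  `inf'_le_inf'_of_gapTest` / `inf'_eq_of_gapTest` — if one vertex `A` is solved free and its own
  multipliers keep every vertex value on the right side of `A`'s optimum, that single bundle is
  value-minimax optimal among ALL shared-multiplier bundles on the cell (pure order reasoning on top of
  weak duality; the crew's "ROUND-0 stop rule").
* (extent rule, after the gap test) `convexOn_sInf_of_combine[_vec]` / `concaveOn_sSup_of_combine[_vec]`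
  — certificate values with FROZEN varying multipliers combine convexly, so the best such value is
  convex (certified uppers) / concave (certified lowers) along the cell (Boyd–Vandenberghe §3.2.5
  partial minimisation; instance `certifiedLower_combine` / `concaveOn_sSup_certifiedLower` in the
  present setting); along a ray from a free vertex the gap test is down-closed in the extent and its
  margin is linearly capped / floored (`downClosed`, `marginCap`, `marginFloor`,
  `box_eq_free_on_subsegments`, and `…_of_concaveOn` mirrors).

It strictly contains the fixed-dual rule (all penalties shared). What is NOT here: strong duality /
existence of multipliers (never needed by certificates); any particular relaxation.

## Mathlib / tree search

`Literature/Computation/Certificates/LagrangianSplitBound.lean` has the two-block separable form of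
Prop. 5.1.3 (`Bertsekas.dualValue_le_of_feasible`, `splitBound_le`) for LINEAR objectives/rows over
`V → ℝ`; the present statements are over an arbitrary primal type with abstract penalties and a
parameter, so neither implies the other cheaply. Mathlib: `Finset.mem_convexHull`,
`Finset.centerMass_eq_of_sum_1`, `convexHull_pi`, `convexHull_pair`, `segment_eq_Icc'`, `AffineMap.decomp`.
The Summits-side `Summit.Ventures.CertifiedManyBodySolver.Transport.BoxCertificate.Icc_subset_convexHull_boxVertices`
(engine, `FixedDualBoxCertificate.lean`) is inlined as a `have` in the box form (not re-declared:
`Literature/` does not import `Summits/`, and a second named copy would be a duplicate).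

## References

* D. P. Bertsekas, *Nonlinear Programming*, 2nd ed., Athena Scientific, 1999, §5.1.2 Prop. 5.1.3
  (Weak Duality Theorem, pointwise proof), §5.1.5 (equality constraints: multipliers of unrestricted
  sign). [cite: Bertsekas1999NonlinearProgramming, Prop. 5.1.3]
* R. T. Rockafellar, *Convex Analysis*, Princeton 1970, §32 Thm 32.2 (extrema of convex functions over
  convex hulls of finite sets — the fixed-dual companion rule). [cite: Rockafellar1970, Thm 32.2]
* S. Boyd, L. Vandenberghe, *Convex Optimization*, Cambridge University Press 2004, §3.2.5
  (minimisation over some variables of a jointly convex function is convex — Jensen proof with the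
  combined point exhibited), §5.6.1 and Exercise 5.32 (the optimal value `p⋆(u,v)` of a convex
  program is convex in the right-hand-side perturbations). [cite: BoydVandenberghe2004, §3.2.5]
-/

namespace Literature.Computation.Certificates.SharedVaryingBox

open Finset

variable {E : Type*} [AddCommGroup E] [Module ℝ E]

/-- A real affine map evaluated at an affine combination (`∑ w = 1`):
`f (Σ_k w_k • v_k) = Σ_k w_k f(v_k)` (linear part plus constant, `AffineMap.decomp`).
[cite: Rockafellar1970, Thm 32.2] -/
theorem affineMap_apply_sum_smul {ι : Type*} (S : Finset ι) (w : ι → ℝ)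
    (hw1 : ∑ k ∈ S, w k = 1) (v : ι → E) (f : E →ᵃ[ℝ] ℝ) :
    f (∑ k ∈ S, w k • v k) = ∑ k ∈ S, w k * f (v k) := by
  have h : ∀ x, f x = f.linear x + f 0 := fun x => by
    have := congrFun f.decomp x
    simpa using this
  calc f (∑ k ∈ S, w k • v k) = f.linear (∑ k ∈ S, w k • v k) + f 0 := h _
    _ = ∑ k ∈ S, w k * f.linear (v k) + (∑ k ∈ S, w k) * f 0 := by
        rw [map_sum, hw1, one_mul]
        simp_rw [map_smul, smul_eq_mul]
    _ = ∑ k ∈ S, w k * f (v k) := by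
        rw [Finset.sum_mul, ← Finset.sum_add_distrib]
        refine Finset.sum_congr rfl fun k _ => ?_
        rw [h (v k)]; ring

/-- **Kernel of the shared-on-varying rule** (weak duality, pointwise form, with the multiplier
assembled from shared and averaged free parts; pure bookkeeping, no parameter space): if the
objective and the shared penalties at the barycentre are the `w`-averages of their vertex values
(`w ≥ 0`), the shared penalties and every vertex's free penalties are nonnegative on the feasible set
`F` of the barycentre program, and each vertex certificate bounds its Lagrangian below by `β k` on
the a-priori domain `D`, then every feasible `y ∈ F ∩ D` has objective `≥ ∑ w k * β k`.
(Bertsekas 1999, Prop. 5.1.3, proof: `q(μ) ≤ f(x) + Σ μⱼgⱼ(x) ≤ f(x)` for feasible `x`.)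
[cite: Bertsekas1999NonlinearProgramming, Prop. 5.1.3] -/
theorem sum_mul_le_of_sharedVarying_kernel {Y ι R R' : Type*} (S : Finset ι) (w : ι → ℝ)
    (hw0 : ∀ k ∈ S, 0 ≤ w k) (F D : Set Y)
    (cbar : Y → ℝ) (cv : ι → Y → ℝ) (hc : ∀ y, cbar y = ∑ k ∈ S, w k * cv k y)
    (Rs : Finset R) (ψbar : R → Y → ℝ) (ψv : R → ι → Y → ℝ)
    (hψ : ∀ r ∈ Rs, ∀ y, ψbar r y = ∑ k ∈ S, w k * ψv r k y)
    (hψpos : ∀ r ∈ Rs, ∀ y ∈ F, 0 ≤ ψbar r y)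
    (Rf : Finset R') (φ : ι → R' → Y → ℝ) (hφpos : ∀ k ∈ S, ∀ r ∈ Rf, ∀ y ∈ F, 0 ≤ φ k r y)
    (β : ι → ℝ) (hβ : ∀ k ∈ S, ∀ y ∈ D, β k ≤ cv k y - ∑ r ∈ Rs, ψv r k y - ∑ r ∈ Rf, φ k r y)
    {y : Y} (hyF : y ∈ F) (hyD : y ∈ D) : ∑ k ∈ S, w k * β k ≤ cbar y := by
  have h1 : ∑ k ∈ S, w k * β k ≤
      ∑ k ∈ S, w k * (cv k y - ∑ r ∈ Rs, ψv r k y - ∑ r ∈ Rf, φ k r y) :=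
    Finset.sum_le_sum fun k hk => mul_le_mul_of_nonneg_left (hβ k hk y hyD) (hw0 k hk)
  have h2 : ∑ k ∈ S, w k * (cv k y - ∑ r ∈ Rs, ψv r k y - ∑ r ∈ Rf, φ k r y) =
      cbar y - ∑ r ∈ Rs, ψbar r y - ∑ k ∈ S, w k * ∑ r ∈ Rf, φ k r y := by
    rw [hc y]
    have : ∑ r ∈ Rs, ψbar r y = ∑ k ∈ S, w k * ∑ r ∈ Rs, ψv r k y := by
      rw [Finset.sum_congr rfl fun r hr => hψ r hr y, Finset.sum_comm]
      simp_rw [Finset.mul_sum]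
    rw [this, ← Finset.sum_sub_distrib, ← Finset.sum_sub_distrib]
    refine Finset.sum_congr rfl fun k _ => by ring
  have h3 : 0 ≤ ∑ r ∈ Rs, ψbar r y := Finset.sum_nonneg fun r hr => hψpos r hr y hyF
  have h4 : 0 ≤ ∑ k ∈ S, w k * ∑ r ∈ Rf, φ k r y :=
    Finset.sum_nonneg fun k hk => mul_nonneg (hw0 k hk)
      (Finset.sum_nonneg fun r hr => hφpos k hk r hr y hyF)
  linarith

/-- **Shared-on-varying certificate at an affine combination of vertices.** Parameter space `E`;
objective `c y` and shared penalties `ψ r y` are real AFFINE maps of the parameter (fixed multiplier ×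
affinely parametrised constraint); free penalties `φ k r` are `θ`-independent and chosen per vertex;
weights `w ≥ 0`, `Σ w = 1`. If every vertex `v k` certifies `β k` on the a-priori domain `D` and all
penalties are nonnegative on the feasible set of the program AT the combination `Σ w k • v k`, then
every `y ∈ F (Σ w • v) ∩ D` has `Σ w k * β k ≤ c y (Σ w • v)`.
[cite: Bertsekas1999NonlinearProgramming, Prop. 5.1.3] -/
theorem sum_mul_le_of_sharedVarying {Y ι R R' : Type*} (S : Finset ι) (w : ι → ℝ)
    (hw0 : ∀ k ∈ S, 0 ≤ w k) (hw1 : ∑ k ∈ S, w k = 1) (v : ι → E)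
    (F : E → Set Y) (D : Set Y) (c : Y → E →ᵃ[ℝ] ℝ)
    (Rs : Finset R) (ψ : R → Y → E →ᵃ[ℝ] ℝ)
    (hψpos : ∀ r ∈ Rs, ∀ y ∈ F (∑ k ∈ S, w k • v k), 0 ≤ ψ r y (∑ k ∈ S, w k • v k))
    (Rf : Finset R') (φ : ι → R' → Y → ℝ)
    (hφpos : ∀ k ∈ S, ∀ r ∈ Rf, ∀ y ∈ F (∑ k ∈ S, w k • v k), 0 ≤ φ k r y)
    (β : ι → ℝ) (hβ : ∀ k ∈ S, ∀ y ∈ D, β k ≤ c y (v k) - ∑ r ∈ Rs, ψ r y (v k) - ∑ r ∈ Rf, φ k r y)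
    {y : Y} (hyF : y ∈ F (∑ k ∈ S, w k • v k)) (hyD : y ∈ D) :
    ∑ k ∈ S, w k * β k ≤ c y (∑ k ∈ S, w k • v k) :=
  sum_mul_le_of_sharedVarying_kernel S w hw0 (F (∑ k ∈ S, w k • v k)) D
    (fun y => c y (∑ k ∈ S, w k • v k)) (fun k y => c y (v k))
    (fun y => affineMap_apply_sum_smul S w hw1 v (c y))
    Rs (fun r y => ψ r y (∑ k ∈ S, w k • v k)) (fun r k y => ψ r y (v k))
    (fun r _ y => affineMap_apply_sum_smul S w hw1 v (ψ r y)) hψpos Rf φ hφpos β hβ hyF hyD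

/-- **Box form** (the `fastlayer-box/2` rule `sharing: theta-rows`): vertex certificates at the
`2^|κ|` corners `Fintype.piFinset fun k => {lo k, hi k}` of `Set.Icc lo hi ⊆ (κ → ℝ)` sharing the
multipliers of the varying constraints (affine penalties `ψ`, nonnegative on feasible points
throughout the box), with free per-vertex penalties `φ v r` (nonnegative on feasible points throughout
the box), each certifying `m` on the a-priori domain `D`, certify `m ≤ c y θ` at EVERY `θ` in the
box for every `y ∈ F θ ∩ D`. (Weak duality at `θ`, the box being the convex hull of its vertices.)
[cite: Bertsekas1999NonlinearProgramming, Prop. 5.1.3] -/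
theorem le_of_forall_boxVertices_sharedVarying {Y R R' κ : Type*} [Fintype κ] [DecidableEq κ]
    (lo hi : κ → ℝ) (F : (κ → ℝ) → Set Y) (D : Set Y) (c : Y → (κ → ℝ) →ᵃ[ℝ] ℝ)
    (Rs : Finset R) (ψ : R → Y → (κ → ℝ) →ᵃ[ℝ] ℝ)
    (hψpos : ∀ θ ∈ Set.Icc lo hi, ∀ r ∈ Rs, ∀ y ∈ F θ, 0 ≤ ψ r y θ)
    (Rf : Finset R') (φ : (κ → ℝ) → R' → Y → ℝ)
    (hφpos : ∀ v ∈ Fintype.piFinset (fun k => ({lo k, hi k} : Finset ℝ)), ∀ r ∈ Rf,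
      ∀ θ ∈ Set.Icc lo hi, ∀ y ∈ F θ, 0 ≤ φ v r y)
    (m : ℝ) (hm : ∀ v ∈ Fintype.piFinset (fun k => ({lo k, hi k} : Finset ℝ)), ∀ y ∈ D,
      m ≤ c y v - ∑ r ∈ Rs, ψ r y v - ∑ r ∈ Rf, φ v r y)
    {θ : κ → ℝ} (hθ : θ ∈ Set.Icc lo hi) {y : Y} (hyF : y ∈ F θ) (hyD : y ∈ D) : m ≤ c y θ := by
  classical
  set T := Fintype.piFinset (fun k => ({lo k, hi k} : Finset ℝ)) with hT
  -- the box lies in the convex hull of its `2^|κ|` vertices (coordinate-wise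
  -- `[lo k, hi k] = conv {lo k, hi k}`, and `conv (Π Sₖ) = Π conv Sₖ`); this is the engine's
  -- Summits-side `…Transport.BoxCertificate.Icc_subset_convexHull_boxVertices`, inlined here
  have hθT : θ ∈ convexHull ℝ (T : Set (κ → ℝ)) := by
    rw [hT, Fintype.coe_piFinset, convexHull_pi]
    simp only [Set.mem_pi, Set.mem_univ, true_implies, Finset.coe_insert, Finset.coe_singleton]
    intro k
    rw [convexHull_pair, segment_eq_Icc']
    exact ⟨le_trans (min_le_left _ _) (hθ.1 k), le_trans (hθ.2 k) (le_max_right _ _)⟩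
  obtain ⟨w, hw0, hw1, hcm⟩ := Finset.mem_convexHull.1 hθT
  have hθeq : ∑ v ∈ T, w v • v = θ := by
    rw [← hcm, Finset.centerMass_eq_of_sum_1 _ _ hw1]; rfl
  have key := sum_mul_le_of_sharedVarying (E := κ → ℝ) T w hw0 hw1 id F D c Rs ψ
    (fun r hr y hy => by
      rw [show (∑ k ∈ T, w k • id k) = θ from hθeq] at hy ⊢; exact hψpos θ hθ r hr y hy)
    Rf φ (fun v hv r hr y hy => hφpos v hv r hr θ hθ y
      (by rwa [show (∑ k ∈ T, w k • id k) = θ from hθeq] at hy))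
    (fun _ => m) (fun v hv y hy => hm v hv y hy)
    (y := y) (by rwa [show (∑ k ∈ T, w k • id k) = θ from hθeq]) hyD
  rw [show (∑ k ∈ T, w k • id k) = θ from hθeq, ← Finset.sum_mul, hw1, one_mul] at key
  exact key

/-- **The fixed-dual rule is the special case with no free penalties**: if ONE dual (all penalties
shared and affine in `θ`) certifies `m` at every vertex of the box, it certifies `m` on the whole
box. [cite: Bertsekas1999NonlinearProgramming, Prop. 5.1.3] -/
theorem le_of_forall_boxVertices_shared {Y R κ : Type*} [Fintype κ] [DecidableEq κ]
    (lo hi : κ → ℝ) (F : (κ → ℝ) → Set Y) (D : Set Y) (c : Y → (κ → ℝ) →ᵃ[ℝ] ℝ)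
    (Rs : Finset R) (ψ : R → Y → (κ → ℝ) →ᵃ[ℝ] ℝ)
    (hψpos : ∀ θ ∈ Set.Icc lo hi, ∀ r ∈ Rs, ∀ y ∈ F θ, 0 ≤ ψ r y θ)
    (m : ℝ) (hm : ∀ v ∈ Fintype.piFinset (fun k => ({lo k, hi k} : Finset ℝ)), ∀ y ∈ D,
      m ≤ c y v - ∑ r ∈ Rs, ψ r y v)
    {θ : κ → ℝ} (hθ : θ ∈ Set.Icc lo hi) {y : Y} (hyF : y ∈ F θ) (hyD : y ∈ D) : m ≤ c y θ := by
  refine le_of_forall_boxVertices_sharedVarying lo hi F D c Rs ψ hψpos (∅ : Finset Unit)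
    (fun _ _ _ => 0) (fun _ _ _ _ _ _ _ _ => le_rfl) m (fun v hv y hy => ?_) hθ hyF hyD
  simpa using hm v hv y hy

/-! ### `n`-extent cells: `θ`-box × `n`-chord, penalties of the form `P θ + n * Q θ`

Over a cell `Set.Icc lo hi × Set.Icc n₁ n₂` (a coupling box times a density interval) a cap row
is naturally MULTI-AFFINE — the `n`-chord of two `θ`-affine majorants, `u(θ,n) = A θ + n * B θ` with
`A, B` affine (bilinear, not affine). Such rows are reproduced exactly by the PRODUCT weights
(convex weights of `θ` over the box vertices) × (the barycentric weights of `n` on `{n₁, n₂}`),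
because `Σₐ ωₐ = 1` and `Σₐ ωₐ·a = n`; density rows with SHARED multipliers and eom / cap rows are
all of the form `P + n*Q`. (Statements typed by the crew's planner hubbard-fast-p1,
`HOME/hubbard-fast-p1/lean/SharedVaryingBoxN.lean`; the barycentric weight
`a ↦ if a = n₂ then (n-n₁)/(n₂-n₁) else (n₂-n)/(n₂-n₁)` is written out instead of named; the
interpolation identities are private helpers.) -/

/-- The barycentric weights of `n` on the pair `{n₁, n₂}` sum to one. [folklore] -/
private theorem chordWeight_sum (n₁ n₂ n : ℝ) (h : n₁ < n₂) :
    ∑ a ∈ ({n₁, n₂} : Finset ℝ),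
      (if a = n₂ then (n - n₁) / (n₂ - n₁) else (n₂ - n) / (n₂ - n₁)) = 1 := by
  rw [Finset.sum_pair (ne_of_lt h)]
  have hne : n₂ - n₁ ≠ 0 := sub_ne_zero.2 (ne_of_gt h)
  simp only [if_neg (ne_of_lt h), if_true]
  rw [← add_div, div_eq_one_iff_eq hne]; ring

/-- The barycentric weights of `n` on `{n₁, n₂}` reproduce `n`. [folklore] -/
private theorem chordWeight_sum_mul (n₁ n₂ n : ℝ) (h : n₁ < n₂) :
    ∑ a ∈ ({n₁, n₂} : Finset ℝ),
      (if a = n₂ then (n - n₁) / (n₂ - n₁) else (n₂ - n) / (n₂ - n₁)) * a = n := by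
  rw [Finset.sum_pair (ne_of_lt h)]
  have hne : n₂ - n₁ ≠ 0 := sub_ne_zero.2 (ne_of_gt h)
  simp only [if_neg (ne_of_lt h), if_true]
  rw [div_mul_eq_mul_div, div_mul_eq_mul_div, ← add_div, div_eq_iff hne]; ring

/-- The barycentric weights of `n ∈ [n₁, n₂]` on `{n₁, n₂}` are nonnegative. [folklore] -/
private theorem chordWeight_nonneg (n₁ n₂ n : ℝ) (h : n₁ < n₂) (hn : n ∈ Set.Icc n₁ n₂) (a : ℝ) :
    0 ≤ (if a = n₂ then (n - n₁) / (n₂ - n₁) else (n₂ - n) / (n₂ - n₁)) := by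
  have hd : 0 < n₂ - n₁ := sub_pos.2 h
  split_ifs
  · exact div_nonneg (sub_nonneg.2 hn.1) hd.le
  · exact div_nonneg (sub_nonneg.2 hn.2) hd.le

/-- Product weights (box-vertex weights × `n`-chord weights) reproduce every `P θ + n * Q θ` with
`P, Q` affine in `θ` (multi-affine interpolation on a box × segment). [folklore] -/
private theorem sum_product_mul_chordWeight_apply (T : Finset E) (w : E → ℝ) (hw1 : ∑ v ∈ T, w v = 1)
    {θ : E} (hθ : ∑ v ∈ T, w v • v = θ) (n₁ n₂ n : ℝ) (h : n₁ < n₂) (P Q : E →ᵃ[ℝ] ℝ) :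
    ∑ p ∈ T ×ˢ ({n₁, n₂} : Finset ℝ),
      (w p.1 * (if p.2 = n₂ then (n - n₁) / (n₂ - n₁) else (n₂ - n) / (n₂ - n₁))) *
        (P p.1 + p.2 * Q p.1) = P θ + n * Q θ := by
  rw [Finset.sum_product]
  have hP : P θ = ∑ v ∈ T, w v * P v := by rw [← hθ]; exact affineMap_apply_sum_smul T w hw1 id P
  have hQ : Q θ = ∑ v ∈ T, w v * Q v := by rw [← hθ]; exact affineMap_apply_sum_smul T w hw1 id Q
  have inner : ∀ v ∈ T, ∑ a ∈ ({n₁, n₂} : Finset ℝ),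
      (w v * (if a = n₂ then (n - n₁) / (n₂ - n₁) else (n₂ - n) / (n₂ - n₁))) * (P v + a * Q v) =
      w v * (P v + n * Q v) := by
    intro v _
    have e1 : ∀ a ∈ ({n₁, n₂} : Finset ℝ),
        (w v * (if a = n₂ then (n - n₁) / (n₂ - n₁) else (n₂ - n) / (n₂ - n₁))) * (P v + a * Q v) =
        w v * ((if a = n₂ then (n - n₁) / (n₂ - n₁) else (n₂ - n) / (n₂ - n₁)) * P v +
          ((if a = n₂ then (n - n₁) / (n₂ - n₁) else (n₂ - n) / (n₂ - n₁)) * a) * Q v) :=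
      fun a _ => by ring
    rw [Finset.sum_congr rfl e1, ← Finset.mul_sum, Finset.sum_add_distrib, ← Finset.sum_mul,
      ← Finset.sum_mul, chordWeight_sum n₁ n₂ n h, chordWeight_sum_mul n₁ n₂ n h, one_mul]
  rw [Finset.sum_congr rfl inner, hP, hQ, Finset.mul_sum, ← Finset.sum_add_distrib]
  refine Finset.sum_congr rfl fun v _ => by ring

/-- **Box × `n`-chord form** (`fastlayer-box/2` with an extent in the density): vertex certificates
at the corners of `Set.Icc lo hi × {n₁, n₂}`, sharing the multipliers of every varying constraint,
with objective and shared penalties of the form `P y θ + n * Q y θ` (`P, Q` affine in `θ`; covers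
bilinear = `n`-chord caps and the density rows), free per-vertex penalties `φ`, each certifying
`m` on the a-priori domain `D`, certify `m ≤ cP y θ + n * cQ y θ` at every `(θ, n)` of the cell for
every `y ∈ F θ n ∩ D`. (Weak duality at `(θ, n)` with the product weights.)
[cite: Bertsekas1999NonlinearProgramming, Prop. 5.1.3] -/
theorem le_of_forall_boxVertices_sharedVarying_nChord {Y R R' κ : Type*} [Fintype κ] [DecidableEq κ]
    (lo hi : κ → ℝ) (n₁ n₂ : ℝ) (hn12 : n₁ < n₂)
    (F : (κ → ℝ) → ℝ → Set Y) (D : Set Y) (cP cQ : Y → (κ → ℝ) →ᵃ[ℝ] ℝ)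
    (Rs : Finset R) (ψP ψQ : R → Y → (κ → ℝ) →ᵃ[ℝ] ℝ)
    (hψpos : ∀ θ ∈ Set.Icc lo hi, ∀ n ∈ Set.Icc n₁ n₂, ∀ r ∈ Rs, ∀ y ∈ F θ n,
      0 ≤ ψP r y θ + n * ψQ r y θ)
    (Rf : Finset R') (φ : (κ → ℝ) × ℝ → R' → Y → ℝ)
    (hφpos : ∀ p ∈ (Fintype.piFinset fun k => ({lo k, hi k} : Finset ℝ)) ×ˢ ({n₁, n₂} : Finset ℝ),
      ∀ r ∈ Rf, ∀ θ ∈ Set.Icc lo hi, ∀ n ∈ Set.Icc n₁ n₂, ∀ y ∈ F θ n, 0 ≤ φ p r y)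
    (m : ℝ) (hm : ∀ p ∈ (Fintype.piFinset fun k => ({lo k, hi k} : Finset ℝ)) ×ˢ ({n₁, n₂} : Finset ℝ),
      ∀ y ∈ D, m ≤ (cP y p.1 + p.2 * cQ y p.1) - ∑ r ∈ Rs, (ψP r y p.1 + p.2 * ψQ r y p.1)
        - ∑ r ∈ Rf, φ p r y)
    {θ : κ → ℝ} (hθ : θ ∈ Set.Icc lo hi) {n : ℝ} (hn : n ∈ Set.Icc n₁ n₂)
    {y : Y} (hyF : y ∈ F θ n) (hyD : y ∈ D) : m ≤ cP y θ + n * cQ y θ := by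
  classical
  set T := Fintype.piFinset (fun k => ({lo k, hi k} : Finset ℝ)) with hT
  -- the box lies in the convex hull of its vertices (as in `le_of_forall_boxVertices_sharedVarying`)
  have hθT : θ ∈ convexHull ℝ (T : Set (κ → ℝ)) := by
    rw [hT, Fintype.coe_piFinset, convexHull_pi]
    simp only [Set.mem_pi, Set.mem_univ, true_implies, Finset.coe_insert, Finset.coe_singleton]
    intro k
    rw [convexHull_pair, segment_eq_Icc']
    exact ⟨le_trans (min_le_left _ _) (hθ.1 k), le_trans (hθ.2 k) (le_max_right _ _)⟩
  obtain ⟨w, hw0, hw1, hcm⟩ := Finset.mem_convexHull.1 hθT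
  have hθeq : ∑ v ∈ T, w v • v = θ := by
    rw [← hcm, Finset.centerMass_eq_of_sum_1 _ _ hw1]; rfl
  set A := ({n₁, n₂} : Finset ℝ) with hA
  set cw : ℝ → ℝ := fun a => if a = n₂ then (n - n₁) / (n₂ - n₁) else (n₂ - n) / (n₂ - n₁) with hcw
  have hW0 : ∀ p ∈ T ×ˢ A, 0 ≤ w p.1 * cw p.2 := fun p hp =>
    mul_nonneg (hw0 p.1 (Finset.mem_product.1 hp).1) (chordWeight_nonneg n₁ n₂ n hn12 hn p.2)
  have hrow : ∀ v ∈ T, ∑ a ∈ A, w v * cw a = w v := fun v _ => by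
    rw [← Finset.mul_sum, hA, hcw, chordWeight_sum n₁ n₂ n hn12, mul_one]
  have hW1 : ∑ p ∈ T ×ˢ A, w p.1 * cw p.2 = 1 := by
    rw [Finset.sum_product, Finset.sum_congr rfl hrow]; exact hw1
  have key := sum_mul_le_of_sharedVarying_kernel (T ×ˢ A) (fun p => w p.1 * cw p.2) hW0 (F θ n) D
    (fun y => cP y θ + n * cQ y θ) (fun p y => cP y p.1 + p.2 * cQ y p.1)
    (fun y => (sum_product_mul_chordWeight_apply T w hw1 hθeq n₁ n₂ n hn12 (cP y) (cQ y)).symm)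
    Rs (fun r y => ψP r y θ + n * ψQ r y θ) (fun r p y => ψP r y p.1 + p.2 * ψQ r y p.1)
    (fun r _ y => (sum_product_mul_chordWeight_apply T w hw1 hθeq n₁ n₂ n hn12 (ψP r y) (ψQ r y)).symm)
    (fun r hr y hy => hψpos θ hθ n hn r hr y hy)
    Rf φ (fun p hp r hr y hy => hφpos p hp r hr θ hθ n hn y hy)
    (fun _ => m) (fun p hp y hy => hm p hp y hy) hyF hyD
  rw [← Finset.sum_mul, hW1, one_mul] at key
  exact key

/-! ### The GAP TEST: value-minimax optimality of a free vertex's own multipliers among all SHARED bundles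

(Crew hubbard-algo planner-p2 TARGET §15.10 "stop rule", checked sketch `GapTest.lean`, restated here next
to the box forms it is about.) A finite vertex set `S` of a parameter cell; a type `Y` of multiplier
vectors SHARED by all vertices (one frozen dual / one `sharing: theta-rows` bundle serves every vertex, as
above); for a MAXIMISATION edge, `ub v y` = the value certified at vertex `v` by the multipliers `y` — by
weak duality (Prop. 5.1.3) an upper bound of the vertex optimum, in particular `fA ≤ ub A y` for EVERY `y`
at a vertex `A` whose optimum is `fA`; the bundle `y` certifies the box value `S.sup' _ (ub · y)` on the
cell (worst vertex, `le_of_forall_boxVertices_shared[Varying]`). If `A` is solved FREE (`ub A y₀ = fA`)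
and its own multipliers `y₀` keep every vertex value under `fA` — the GAP TEST `ub v y₀ ≤ fA` — then the
box value of `y₀` is `fA` and is `≤` the box value of ANY shared `y`: no joint solve, dual decomposition
or subgradient iterate over shared multipliers can improve on the free vertex's bundle ("ROUND-0").
Mirror statements for MINIMISATION edges (certified lower values `lb`, box value `S.inf'`, larger is
better). Pure order reasoning on top of weak duality.
-/

/-- **Gap test, pointwise**: weak duality at the free vertex `A` (`fA ≤ ub A y` for all `y`) and the
gap test for `y₀` (`ub v y₀ ≤ fA` on `S`) give `ub v y₀ ≤ ub A y` for every `v ∈ S` and every `y`.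
[cite: Bertsekas1999NonlinearProgramming, Prop. 5.1.3] -/
theorem le_of_gapTest {V Y : Type*} (S : Finset V) (ub : V → Y → ℝ) {A : V} {fA : ℝ} {y₀ : Y}
    (hweak : ∀ y, fA ≤ ub A y) (hgap : ∀ v ∈ S, ub v y₀ ≤ fA) {v : V} (hv : v ∈ S) (y : Y) :
    ub v y₀ ≤ ub A y :=
  (hgap v hv).trans (hweak y)

/-- **Gap test ⇒ value-minimax optimality (maximisation edge).** If `A ∈ S`, `fA ≤ ub A y` for every
shared `y` (weak duality at `A`) and `ub v y₀ ≤ fA` for every `v ∈ S` (gap test), then the box value of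
`y₀` is at most the box value of any `y`: `S.sup' (ub · y₀) ≤ S.sup' (ub · y)`.
[cite: Bertsekas1999NonlinearProgramming, Prop. 5.1.3] -/
theorem sup'_le_sup'_of_gapTest {V Y : Type*} (S : Finset V) (hS : S.Nonempty) (ub : V → Y → ℝ)
    {A : V} (hA : A ∈ S) {fA : ℝ} {y₀ : Y}
    (hweak : ∀ y, fA ≤ ub A y) (hgap : ∀ v ∈ S, ub v y₀ ≤ fA) (y : Y) :
    S.sup' hS (fun v => ub v y₀) ≤ S.sup' hS (fun v => ub v y) :=
  Finset.sup'_le hS _ fun _ hv =>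
    (le_of_gapTest S ub hweak hgap hv y).trans (Finset.le_sup' (fun w => ub w y) hA)

/-- **Under the gap test the box value IS the free vertex value**: `ub A y₀ = fA`, `A ∈ S`, and
`ub v y₀ ≤ fA` on `S` give `S.sup' (ub · y₀) = fA`. [cite: Bertsekas1999NonlinearProgramming, Prop. 5.1.3] -/
theorem sup'_eq_of_gapTest {V Y : Type*} (S : Finset V) (hS : S.Nonempty) (ub : V → Y → ℝ)
    {A : V} (hA : A ∈ S) {fA : ℝ} {y₀ : Y} (hfree : ub A y₀ = fA) (hgap : ∀ v ∈ S, ub v y₀ ≤ fA) :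
    S.sup' hS (fun v => ub v y₀) = fA :=
  le_antisymm (Finset.sup'_le hS _ hgap) (hfree ▸ Finset.le_sup' (fun w => ub w y₀) hA)

/-- **Gap test, minimisation edge** (certified LOWER values `lb v y ≤` vertex optimum; box value
`S.inf'`, larger is better): weak duality at the free vertex `lb A y ≤ fA` for all `y` and the gap test
`fA ≤ lb v y₀` on `S` give `S.inf' (lb · y) ≤ S.inf' (lb · y₀)` for every shared `y`.
[cite: Bertsekas1999NonlinearProgramming, Prop. 5.1.3] -/
theorem inf'_le_inf'_of_gapTest {V Y : Type*} (S : Finset V) (hS : S.Nonempty) (lb : V → Y → ℝ)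
    {A : V} (hA : A ∈ S) {fA : ℝ} {y₀ : Y}
    (hweak : ∀ y, lb A y ≤ fA) (hgap : ∀ v ∈ S, fA ≤ lb v y₀) (y : Y) :
    S.inf' hS (fun v => lb v y) ≤ S.inf' hS (fun v => lb v y₀) :=
  Finset.le_inf' hS _ fun v hv =>
    (Finset.inf'_le (fun w => lb w y) hA).trans ((hweak y).trans (hgap v hv))

/-- Minimisation edge: under the gap test the box value is the free vertex value,
`S.inf' (lb · y₀) = fA`. [cite: Bertsekas1999NonlinearProgramming, Prop. 5.1.3] -/
theorem inf'_eq_of_gapTest {V Y : Type*} (S : Finset V) (hS : S.Nonempty) (lb : V → Y → ℝ)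
    {A : V} (hA : A ∈ S) {fA : ℝ} {y₀ : Y} (hfree : lb A y₀ = fA) (hgap : ∀ v ∈ S, fA ≤ lb v y₀) :
    S.inf' hS (fun v => lb v y₀) = fA :=
  le_antisymm (hfree ▸ Finset.inf'_le (fun w => lb w y₀) hA) (Finset.le_inf' hS _ hgap)

/-! ### The EXTENT RULE: values certified with FROZEN varying multipliers are convex / concave along the cell

(Crew hubbard-fast, planner-p1 TARGET ▶ READING (v0.8i) (i1), checked sketch
`HOME/hubbard-fast-p1/lean/ExtentRule.lean` sha256 2ae8293d…: the names `convexOn_sInf_of_combine[_vec]`,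
`downClosed`, `marginCap`, `marginFloor`, `box_eq_free_on_subsegments` and their statements are the
planner's VERBATIM; the minimisation-edge mirrors `…_of_concaveOn` and the instance in this file's own
setting (`certifiedLower_combine`, `certifiedLower_le`, `bddAbove_certifiedLower`,
`concaveOn_sSup_certifiedLower`) are added here.)

Freeze the SHARED (varying-row) multipliers of one bundle — in the crew's use the FREE optimum's at an
anchor vertex `A` of the cell ("binding-corner ROUND-0") — and at each parameter `θ` re-optimise only
the FREE parts (multipliers of `θ`-independent rows): `C θ ⊆ ℝ` is the set of values so certifiable at
`θ`. Because the objective and the frozen varying penalties are AFFINE in `θ` and the admissible free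
penalty parts form a CONVEX family, such certificates COMBINE: `β₁ ∈ C θ₁`, `β₂ ∈ C θ₂`, `a, b ≥ 0`,
`a + b = 1` give `a β₁ + b β₂ ∈ C (a • θ₁ + b • θ₂)` (`certifiedLower_combine` — the assembly step of
`sum_mul_le_of_sharedVarying` read with two vertices; each element of `C θ` is a genuine lower bound
on `F θ ∩ D` by weak duality, `certifiedLower_le`). Hence the best frozen-bundle certified LOWER value
`θ ↦ sSup (C θ)` is CONCAVE on the cell (`concaveOn_sSup_certifiedLower`, via the abstract
`concaveOn_sSup_of_combine_vec`), and for a MAXIMISATION edge (certified upper values, negate the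
objective) the best frozen-bundle certified UPPER value `θ ↦ sInf (C θ)` is CONVEX
(`convexOn_sInf_of_combine_vec`; ray form `convexOn_sInf_of_combine`). This is Boyd–Vandenberghe's
partial-minimisation rule — `g(x) = inf_{y ∈ C} f(x,y)` is convex when `f` is jointly convex, proved
by exhibiting the combined point (§3.2.5) — and, read on programs, the convexity of the optimal value
of a convex program in right-hand-side perturbations (§5.6.1, Exercise 5.32); here the joint convexity
is exactly the hypothesis `hcomb` ("certificates combine"), which the crew's box checker verifies
operationally (B5′ interpolant test).

Consequences along a ray `s ↦ θ(s)`, `s ≥ 0`, from a vertex solved FREE with optimum `fA` (so the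
frozen bundle completes itself there: `u 0 ≤ fA`), for a maximisation edge with reduced certified upper
value `u`, convex on `Set.Ici 0`:
* `downClosed` — the GAP TEST `u s ≤ fA` is DOWN-CLOSED in the extent: passing at `s₀` it passes at
  every `0 ≤ s ≤ s₀` (the passing extents form an interval; bisection for the maximal one is sound);
* `marginCap` — beyond a probed extent the margin grows AT MOST linearly:
  `fA - u s ≤ (s / s₀) * (fA - u s₀)` for `0 < s₀ ≤ s`;
* `marginFloor` — inside a probed extent it is dominated linearly from below:
  `(s / s₀) * (fA - u s₀) ≤ fA - u s` for `0 < s ≤ s₀`;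
* `box_eq_free_on_subsegments` — with `u 0 = fA` and a passing far vertex, the two-vertex box value
  `max (u 0) (u s)` is `fA` on every sub-segment (ties to `sup'_eq_of_gapTest`);
and the mirrors `downClosed_of_concaveOn`, `marginCap_of_concaveOn`, `marginFloor_of_concaveOn`,
`box_eq_free_on_subsegments_of_concaveOn` for MINIMISATION edges (reduced certified lower value `l`
concave, `fA ≤ l 0`, gap test `fA ≤ l s`, margin `l s - fA`). Order/convexity bookkeeping about
certificate values; no particular relaxation, no physics.
-/

/-- **Partial minimisation is convex — abstract "certificates combine" form, vector parameter**
(Boyd–Vandenberghe §3.2.5, the Jensen-inequality proof with the combined point exhibited; §5.6.1 /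
Ex. 5.32 for optimal values of convex programs under right-hand-side perturbation). On a convex
parameter set `S`, if every `C p` (`p ∈ S`) is nonempty and bounded below and certificate values
COMBINE — `x₁ ∈ C p₁`, `x₂ ∈ C p₂`, convex weights `a, b` ⇒ some `x ≤ a x₁ + b x₂` lies in
`C (a • p₁ + b • p₂)` — then `p ↦ sInf (C p)` is convex on `S`. Covers the 2-D cell `θ = (t′, U)`
jointly and any parameter entering the reduced program's right-hand side affinely (e.g. the frozen
dual itself). [cite: BoydVandenberghe2004, §3.2.5] -/
theorem convexOn_sInf_of_combine_vec (S : Set E) (hS : Convex ℝ S) (C : E → Set ℝ)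
    (hne : ∀ p ∈ S, (C p).Nonempty) (hbdd : ∀ p ∈ S, BddBelow (C p))
    (hcomb : ∀ ⦃p₁ p₂ : E⦄ ⦃x₁ x₂ a b : ℝ⦄, p₁ ∈ S → p₂ ∈ S → x₁ ∈ C p₁ → x₂ ∈ C p₂ →
      0 ≤ a → 0 ≤ b → a + b = 1 → ∃ x ∈ C (a • p₁ + b • p₂), x ≤ a * x₁ + b * x₂) :
    ConvexOn ℝ S (fun p => sInf (C p)) := by
  refine ⟨hS, ?_⟩
  intro p₁ hp₁ p₂ hp₂ a b ha hb hab
  simp only [smul_eq_mul]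
  have hmix : a • p₁ + b • p₂ ∈ S := hS hp₁ hp₂ ha hb hab
  have key : ∀ x₁ ∈ C p₁, ∀ x₂ ∈ C p₂, sInf (C (a • p₁ + b • p₂)) ≤ a * x₁ + b * x₂ := by
    intro x₁ hx₁ x₂ hx₂
    obtain ⟨x, hx, hle⟩ := hcomb hp₁ hp₂ hx₁ hx₂ ha hb hab
    exact (csInf_le (hbdd _ hmix) hx).trans hle
  have step1 : ∀ x₂ ∈ C p₂, sInf (C (a • p₁ + b • p₂)) ≤ a * sInf (C p₁) + b * x₂ := by
    intro x₂ hx₂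
    rcases ha.eq_or_lt with h0 | ha'
    · subst h0
      obtain ⟨x₁, hx₁⟩ := hne p₁ hp₁
      have := key x₁ hx₁ x₂ hx₂
      simpa using this
    · have h : (sInf (C (a • p₁ + b • p₂)) - b * x₂) / a ≤ sInf (C p₁) := by
        refine le_csInf (hne p₁ hp₁) ?_
        intro x₁ hx₁
        rw [div_le_iff₀ ha']
        have := key x₁ hx₁ x₂ hx₂
        linarith
      rw [div_le_iff₀ ha'] at h
      linarith
  rcases hb.eq_or_lt with h0 | hb'
  · subst h0
    obtain ⟨x₂, hx₂⟩ := hne p₂ hp₂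
    have := step1 x₂ hx₂
    simpa using this
  · have h : (sInf (C (a • p₁ + b • p₂)) - a * sInf (C p₁)) / b ≤ sInf (C p₂) := by
      refine le_csInf (hne p₂ hp₂) ?_
      intro x₂ hx₂
      rw [div_le_iff₀ hb']
      have := step1 x₂ hx₂
      linarith
    rw [div_le_iff₀ hb'] at h
    linarith

/-- **Ray form** of `convexOn_sInf_of_combine_vec` (parameter `s ≥ 0` along `θ(s) = A + s • d`): if
certificate values at extents `s₁, s₂ ≥ 0` combine convexly into (something at least as good as) a
certificate value at the interpolated extent, the reduced value `s ↦ sInf (C s)` is convex on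
`Set.Ici 0`. [cite: BoydVandenberghe2004, §3.2.5] -/
theorem convexOn_sInf_of_combine (C : ℝ → Set ℝ)
    (hne : ∀ s, 0 ≤ s → (C s).Nonempty) (hbdd : ∀ s, 0 ≤ s → BddBelow (C s))
    (hcomb : ∀ ⦃s₁ s₂ x₁ x₂ a b : ℝ⦄, 0 ≤ s₁ → 0 ≤ s₂ → x₁ ∈ C s₁ → x₂ ∈ C s₂ →
      0 ≤ a → 0 ≤ b → a + b = 1 → ∃ x ∈ C (a * s₁ + b * s₂), x ≤ a * x₁ + b * x₂) :
    ConvexOn ℝ (Set.Ici 0) (fun s => sInf (C s)) :=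
  convexOn_sInf_of_combine_vec (Set.Ici (0 : ℝ)) (convex_Ici 0) C (fun s hs => hne s hs)
    (fun s hs => hbdd s hs)
    (fun _ _ _ _ _ _ hp₁ hp₂ hx₁ hx₂ ha hb hab => by
      simpa only [smul_eq_mul] using hcomb hp₁ hp₂ hx₁ hx₂ ha hb hab)

/-- **Partial maximisation of certified LOWER values is concave** (mirror of
`convexOn_sInf_of_combine_vec` for minimisation edges / lower certificates): on a convex `S`, if every
`C p` is nonempty and bounded above and `x₁ ∈ C p₁`, `x₂ ∈ C p₂`, convex weights `a, b` always give
some `x ≥ a x₁ + b x₂` in `C (a • p₁ + b • p₂)`, then `p ↦ sSup (C p)` is concave on `S`.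
[cite: BoydVandenberghe2004, §3.2.5] -/
theorem concaveOn_sSup_of_combine_vec (S : Set E) (hS : Convex ℝ S) (C : E → Set ℝ)
    (hne : ∀ p ∈ S, (C p).Nonempty) (hbdd : ∀ p ∈ S, BddAbove (C p))
    (hcomb : ∀ ⦃p₁ p₂ : E⦄ ⦃x₁ x₂ a b : ℝ⦄, p₁ ∈ S → p₂ ∈ S → x₁ ∈ C p₁ → x₂ ∈ C p₂ →
      0 ≤ a → 0 ≤ b → a + b = 1 → ∃ x ∈ C (a • p₁ + b • p₂), a * x₁ + b * x₂ ≤ x) :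
    ConcaveOn ℝ S (fun p => sSup (C p)) := by
  refine ⟨hS, ?_⟩
  intro p₁ hp₁ p₂ hp₂ a b ha hb hab
  simp only [smul_eq_mul]
  have hmix : a • p₁ + b • p₂ ∈ S := hS hp₁ hp₂ ha hb hab
  have key : ∀ x₁ ∈ C p₁, ∀ x₂ ∈ C p₂, a * x₁ + b * x₂ ≤ sSup (C (a • p₁ + b • p₂)) := by
    intro x₁ hx₁ x₂ hx₂
    obtain ⟨x, hx, hle⟩ := hcomb hp₁ hp₂ hx₁ hx₂ ha hb hab
    exact hle.trans (le_csSup (hbdd _ hmix) hx)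
  have step1 : ∀ x₂ ∈ C p₂, a * sSup (C p₁) + b * x₂ ≤ sSup (C (a • p₁ + b • p₂)) := by
    intro x₂ hx₂
    rcases ha.eq_or_lt with h0 | ha'
    · subst h0
      obtain ⟨x₁, hx₁⟩ := hne p₁ hp₁
      have := key x₁ hx₁ x₂ hx₂
      simpa using this
    · have h : sSup (C p₁) ≤ (sSup (C (a • p₁ + b • p₂)) - b * x₂) / a := by
        refine csSup_le (hne p₁ hp₁) ?_
        intro x₁ hx₁
        rw [le_div_iff₀ ha']
        have := key x₁ hx₁ x₂ hx₂
        linarith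
      rw [le_div_iff₀ ha'] at h
      linarith
  rcases hb.eq_or_lt with h0 | hb'
  · subst h0
    obtain ⟨x₂, hx₂⟩ := hne p₂ hp₂
    have := step1 x₂ hx₂
    simpa using this
  · have h : sSup (C p₂) ≤ (sSup (C (a • p₁ + b • p₂)) - a * sSup (C p₁)) / b := by
      refine csSup_le (hne p₂ hp₂) ?_
      intro x₂ hx₂
      rw [le_div_iff₀ hb']
      have := step1 x₂ hx₂
      linarith
    rw [le_div_iff₀ hb'] at h
    linarith

/-- Ray form of `concaveOn_sSup_of_combine_vec`: the reduced certified LOWER value of a minimisation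
edge along `s ≥ 0` is concave when certificates combine. [cite: BoydVandenberghe2004, §3.2.5] -/
theorem concaveOn_sSup_of_combine (C : ℝ → Set ℝ)
    (hne : ∀ s, 0 ≤ s → (C s).Nonempty) (hbdd : ∀ s, 0 ≤ s → BddAbove (C s))
    (hcomb : ∀ ⦃s₁ s₂ x₁ x₂ a b : ℝ⦄, 0 ≤ s₁ → 0 ≤ s₂ → x₁ ∈ C s₁ → x₂ ∈ C s₂ →
      0 ≤ a → 0 ≤ b → a + b = 1 → ∃ x ∈ C (a * s₁ + b * s₂), a * x₁ + b * x₂ ≤ x) :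
    ConcaveOn ℝ (Set.Ici 0) (fun s => sSup (C s)) :=
  concaveOn_sSup_of_combine_vec (Set.Ici (0 : ℝ)) (convex_Ici 0) C (fun s hs => hne s hs)
    (fun s hs => hbdd s hs)
    (fun _ _ _ _ _ _ hp₁ hp₂ hx₁ hx₂ ha hb hab => by
      simpa only [smul_eq_mul] using hcomb hp₁ hp₂ hx₁ hx₂ ha hb hab)

/-- **Frozen-varying lower certificates COMBINE** (the assembly step of `sum_mul_le_of_sharedVarying`,
two vertices): objective `c y` and the frozen varying penalties `ψ r y` affine in the parameter, free
penalty parts ranging over a CONVEX family `Φ` of functions of the primal point; the value set at `θ`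
is `{β | ∃ φ ∈ Φ, ∀ y ∈ D, β ≤ c y θ - Σ_r ψ r y θ - φ y}` (Lagrangian lower bounds on the a-priori
domain `D`). Then `β₁` certified at `θ₁` and `β₂` at `θ₂` give `a β₁ + b β₂` certified at
`a • θ₁ + b • θ₂` (free part `a • φ₁ + b • φ₂`). [cite: Bertsekas1999NonlinearProgramming, Prop. 5.1.3] -/
theorem certifiedLower_combine {Y R : Type*} (D : Set Y) (c : Y → E →ᵃ[ℝ] ℝ)
    (Rs : Finset R) (ψ : R → Y → E →ᵃ[ℝ] ℝ) (Φ : Set (Y → ℝ)) (hΦ : Convex ℝ Φ)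
    {θ₁ θ₂ : E} {β₁ β₂ a b : ℝ}
    (h₁ : β₁ ∈ {β : ℝ | ∃ φ ∈ Φ, ∀ y ∈ D, β ≤ c y θ₁ - ∑ r ∈ Rs, ψ r y θ₁ - φ y})
    (h₂ : β₂ ∈ {β : ℝ | ∃ φ ∈ Φ, ∀ y ∈ D, β ≤ c y θ₂ - ∑ r ∈ Rs, ψ r y θ₂ - φ y})
    (ha : 0 ≤ a) (hb : 0 ≤ b) (hab : a + b = 1) :
    a * β₁ + b * β₂ ∈ {β : ℝ | ∃ φ ∈ Φ, ∀ y ∈ D,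
      β ≤ c y (a • θ₁ + b • θ₂) - ∑ r ∈ Rs, ψ r y (a • θ₁ + b • θ₂) - φ y} := by
  obtain ⟨φ₁, hφ₁, hβ₁⟩ := h₁
  obtain ⟨φ₂, hφ₂, hβ₂⟩ := h₂
  refine ⟨a • φ₁ + b • φ₂, hΦ hφ₁ hφ₂ ha hb hab, fun y hy => ?_⟩
  have hc : c y (a • θ₁ + b • θ₂) = a * c y θ₁ + b * c y θ₂ := by
    rw [Convex.combo_affine_apply hab]; simp only [smul_eq_mul]
  have hψ : ∑ r ∈ Rs, ψ r y (a • θ₁ + b • θ₂) =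
      a * ∑ r ∈ Rs, ψ r y θ₁ + b * ∑ r ∈ Rs, ψ r y θ₂ := by
    rw [Finset.mul_sum, Finset.mul_sum, ← Finset.sum_add_distrib]
    refine Finset.sum_congr rfl fun r _ => ?_
    rw [Convex.combo_affine_apply hab]; simp only [smul_eq_mul]
  have e1 := mul_le_mul_of_nonneg_left (hβ₁ y hy) ha
  have e2 := mul_le_mul_of_nonneg_left (hβ₂ y hy) hb
  simp only [Pi.add_apply, Pi.smul_apply, smul_eq_mul]
  rw [hc, hψ]
  linarith

/-- **Each frozen-varying certificate value is a genuine lower bound** (weak duality, Prop. 5.1.3,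
pointwise): if the frozen varying penalties and every admissible free part are nonnegative on the
feasible set `F` of the program at `θ`, then every `β` in the value set at `θ` satisfies `β ≤ c y θ`
for all `y ∈ F ∩ D`. [cite: Bertsekas1999NonlinearProgramming, Prop. 5.1.3] -/
theorem certifiedLower_le {Y R : Type*} (F D : Set Y) (c : Y → E →ᵃ[ℝ] ℝ)
    (Rs : Finset R) (ψ : R → Y → E →ᵃ[ℝ] ℝ) (Φ : Set (Y → ℝ)) {θ : E}
    (hψpos : ∀ r ∈ Rs, ∀ y ∈ F, 0 ≤ ψ r y θ) (hΦpos : ∀ φ ∈ Φ, ∀ y ∈ F, 0 ≤ φ y)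
    {β : ℝ} (hβ : β ∈ {β : ℝ | ∃ φ ∈ Φ, ∀ y ∈ D, β ≤ c y θ - ∑ r ∈ Rs, ψ r y θ - φ y})
    {y : Y} (hyF : y ∈ F) (hyD : y ∈ D) : β ≤ c y θ := by
  obtain ⟨φ, hφ, h⟩ := hβ
  have h1 := h y hyD
  have h2 : 0 ≤ ∑ r ∈ Rs, ψ r y θ := Finset.sum_nonneg fun r hr => hψpos r hr y hyF
  have h3 := hΦpos φ hφ y hyF
  linarith

/-- Under the hypotheses of `certifiedLower_le` and primal feasibility (`F ∩ D` nonempty) the value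
set at `θ` is bounded above (by the objective at any feasible point).
[cite: Bertsekas1999NonlinearProgramming, Prop. 5.1.3] -/
theorem bddAbove_certifiedLower {Y R : Type*} (F D : Set Y) (c : Y → E →ᵃ[ℝ] ℝ)
    (Rs : Finset R) (ψ : R → Y → E →ᵃ[ℝ] ℝ) (Φ : Set (Y → ℝ)) {θ : E}
    (hψpos : ∀ r ∈ Rs, ∀ y ∈ F, 0 ≤ ψ r y θ) (hΦpos : ∀ φ ∈ Φ, ∀ y ∈ F, 0 ≤ φ y)
    (hfeas : (F ∩ D).Nonempty) :
    BddAbove {β : ℝ | ∃ φ ∈ Φ, ∀ y ∈ D, β ≤ c y θ - ∑ r ∈ Rs, ψ r y θ - φ y} := by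
  obtain ⟨y, hyF, hyD⟩ := hfeas
  exact ⟨c y θ, fun β hβ => certifiedLower_le F D c Rs ψ Φ hψpos hΦpos hβ hyF hyD⟩

/-- **The best frozen-bundle certified lower value is CONCAVE on the cell** (instance of
`concaveOn_sSup_of_combine_vec` in this file's setting): objective and frozen varying penalties affine
in `θ`, free parts from a convex family `Φ`; if the value set is nonempty and bounded above at every
`θ` of a convex `S` (e.g. `bddAbove_certifiedLower`), then `θ ↦ sSup {β | ∃ φ ∈ Φ, ∀ y ∈ D,
β ≤ c y θ - Σ_r ψ r y θ - φ y}` is concave on `S`. (For a maximisation edge negate the objective: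
the best certified UPPER value is convex — `convexOn_sInf_of_combine_vec`.)
[cite: BoydVandenberghe2004, §5.6.1] -/
theorem concaveOn_sSup_certifiedLower {Y R : Type*} (S : Set E) (hS : Convex ℝ S) (D : Set Y)
    (c : Y → E →ᵃ[ℝ] ℝ) (Rs : Finset R) (ψ : R → Y → E →ᵃ[ℝ] ℝ) (Φ : Set (Y → ℝ))
    (hΦ : Convex ℝ Φ)
    (hne : ∀ θ ∈ S, {β : ℝ | ∃ φ ∈ Φ, ∀ y ∈ D, β ≤ c y θ - ∑ r ∈ Rs, ψ r y θ - φ y}.Nonempty)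
    (hbdd : ∀ θ ∈ S, BddAbove {β : ℝ | ∃ φ ∈ Φ, ∀ y ∈ D, β ≤ c y θ - ∑ r ∈ Rs, ψ r y θ - φ y}) :
    ConcaveOn ℝ S (fun θ =>
      sSup {β : ℝ | ∃ φ ∈ Φ, ∀ y ∈ D, β ≤ c y θ - ∑ r ∈ Rs, ψ r y θ - φ y}) :=
  concaveOn_sSup_of_combine_vec S hS _ hne hbdd
    (fun _ _ _ _ _ _ _ _ hx₁ hx₂ ha hb hab =>
      ⟨_, certifiedLower_combine D c Rs ψ Φ hΦ hx₁ hx₂ ha hb hab, le_rfl⟩)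

/-- **DOWN-CLOSED gap test** (maximisation edge; `u` = reduced certified upper value along the ray,
convex on `s ≥ 0`, completing itself at the free vertex: `u 0 ≤ fA`): a gap test `u s₀ ≤ fA` that
passes at extent `s₀` passes at every `0 ≤ s ≤ s₀` — the passing extents form an interval and bisection
for the maximal extent is sound. [cite: BoydVandenberghe2004, §3.2.5] -/
theorem downClosed {u : ℝ → ℝ} {fA s₀ s : ℝ} (hu : ConvexOn ℝ (Set.Ici 0) u) (h0 : u 0 ≤ fA)
    (hs₀ : u s₀ ≤ fA) (hs : 0 ≤ s) (hss : s ≤ s₀) : u s ≤ fA := by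
  have hseg : s ∈ segment ℝ 0 s₀ := by
    rw [segment_eq_Icc (hs.trans hss)]
    exact ⟨hs, hss⟩
  have h := hu.le_on_segment (Set.mem_Ici.2 le_rfl) (Set.mem_Ici.2 (hs.trans hss)) hseg
  exact h.trans (max_le h0 hs₀)

/-- **LINEAR CAP on the margin** (maximisation edge): beyond a probed extent `s₀ > 0` the margin
`fA - u s` grows at most linearly, `fA - u s ≤ (s / s₀) * (fA - u s₀)` for `s ≥ s₀` (convexity of `u`
on `s ≥ 0` with `u 0 ≤ fA`). [cite: BoydVandenberghe2004, §3.2.5] -/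
theorem marginCap {u : ℝ → ℝ} {fA s₀ s : ℝ} (hu : ConvexOn ℝ (Set.Ici 0) u) (h0 : u 0 ≤ fA)
    (hs₀ : 0 < s₀) (hss : s₀ ≤ s) : fA - u s ≤ (s / s₀) * (fA - u s₀) := by
  have hs : 0 < s := hs₀.trans_le hss
  have hb : 0 ≤ s₀ / s := by positivity
  have ha : 0 ≤ 1 - s₀ / s := by
    rw [sub_nonneg, div_le_one hs]
    exact hss
  have key := hu.2 (Set.mem_Ici.2 (le_refl (0:ℝ))) (Set.mem_Ici.2 hs.le) ha hb (by ring)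
  simp only [smul_eq_mul, mul_zero, zero_add] at key
  have e0 : s₀ / s * s = s₀ := by field_simp
  rw [e0] at key
  have k2 := mul_le_mul_of_nonneg_left key hs.le
  have e1 : s * ((1 - s₀ / s) * u 0 + s₀ / s * u s) = (s - s₀) * u 0 + s₀ * u s := by
    field_simp
  rw [e1] at k2
  have k3 : (s - s₀) * u 0 ≤ (s - s₀) * fA := mul_le_mul_of_nonneg_left h0 (sub_nonneg.2 hss)
  rw [div_mul_eq_mul_div, le_div_iff₀ hs₀]
  nlinarith [k2, k3]

/-- **LINEAR FLOOR on the margin inside a probed extent** (maximisation edge): for `0 < s ≤ s₀`,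
`(s / s₀) * (fA - u s₀) ≤ fA - u s`; with `downClosed`, the margin per unit extent is non-increasing.
[cite: BoydVandenberghe2004, §3.2.5] -/
theorem marginFloor {u : ℝ → ℝ} {fA s₀ s : ℝ} (hu : ConvexOn ℝ (Set.Ici 0) u) (h0 : u 0 ≤ fA)
    (hs : 0 < s) (hss : s ≤ s₀) : (s / s₀) * (fA - u s₀) ≤ fA - u s := by
  have hs₀ : 0 < s₀ := hs.trans_le hss
  have cap := marginCap (u := u) (fA := fA) hu h0 hs hss
  rw [div_mul_eq_mul_div, div_le_iff₀ hs₀]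
  rw [div_mul_eq_mul_div, le_div_iff₀ hs] at cap
  nlinarith [cap]

/-- **Gap test ⇒ whole-interval ROUND-0** (maximisation edge; ties the ray statements to
`sup'_eq_of_gapTest`): if the free vertex has `u 0 = fA` and the far vertex `s₀` passes, every
intermediate extent passes, so the two-vertex box value `max (u 0) (u s)` is `fA` on every sub-segment
`[0, s]`, `s ≤ s₀`. [cite: BoydVandenberghe2004, §3.2.5] -/
theorem box_eq_free_on_subsegments {u : ℝ → ℝ} {fA s₀ : ℝ} (hu : ConvexOn ℝ (Set.Ici 0) u)
    (hfree : u 0 = fA) (hgap : u s₀ ≤ fA) (_hs₀ : 0 ≤ s₀) :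
    ∀ s, 0 ≤ s → s ≤ s₀ → max (u 0) (u s) = fA := by
  intro s hs hss
  have h := downClosed hu hfree.le hgap hs hss
  rw [hfree]
  exact max_eq_left h

/-- Minimisation-edge mirror of `downClosed` (`l` = reduced certified LOWER value along the ray,
concave on `s ≥ 0`, `fA ≤ l 0`): a gap test `fA ≤ l s₀` passing at `s₀` passes at every
`0 ≤ s ≤ s₀`. [cite: BoydVandenberghe2004, §3.2.5] -/
theorem downClosed_of_concaveOn {l : ℝ → ℝ} {fA s₀ s : ℝ} (hl : ConcaveOn ℝ (Set.Ici 0) l)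
    (h0 : fA ≤ l 0) (hs₀ : fA ≤ l s₀) (hs : 0 ≤ s) (hss : s ≤ s₀) : fA ≤ l s := by
  have h := downClosed (u := fun x => -l x) (fA := -fA) hl.neg (neg_le_neg h0) (neg_le_neg hs₀)
    hs hss
  exact neg_le_neg_iff.1 h

/-- Minimisation-edge mirror of `marginCap`: for `0 < s₀ ≤ s`,
`l s - fA ≤ (s / s₀) * (l s₀ - fA)`. [cite: BoydVandenberghe2004, §3.2.5] -/
theorem marginCap_of_concaveOn {l : ℝ → ℝ} {fA s₀ s : ℝ} (hl : ConcaveOn ℝ (Set.Ici 0) l)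
    (h0 : fA ≤ l 0) (hs₀ : 0 < s₀) (hss : s₀ ≤ s) : l s - fA ≤ (s / s₀) * (l s₀ - fA) := by
  have h := marginCap (u := fun x => -l x) (fA := -fA) hl.neg (neg_le_neg h0) hs₀ hss
  have e1 : -fA - -l s = l s - fA := by ring
  have e2 : -fA - -l s₀ = l s₀ - fA := by ring
  rw [e1, e2] at h
  exact h

/-- Minimisation-edge mirror of `marginFloor`: for `0 < s ≤ s₀`,
`(s / s₀) * (l s₀ - fA) ≤ l s - fA`. [cite: BoydVandenberghe2004, §3.2.5] -/
theorem marginFloor_of_concaveOn {l : ℝ → ℝ} {fA s₀ s : ℝ} (hl : ConcaveOn ℝ (Set.Ici 0) l)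
    (h0 : fA ≤ l 0) (hs : 0 < s) (hss : s ≤ s₀) : (s / s₀) * (l s₀ - fA) ≤ l s - fA := by
  have h := marginFloor (u := fun x => -l x) (fA := -fA) hl.neg (neg_le_neg h0) hs hss
  have e1 : -fA - -l s = l s - fA := by ring
  have e2 : -fA - -l s₀ = l s₀ - fA := by ring
  rw [e1, e2] at h
  exact h

/-- Minimisation-edge mirror of `box_eq_free_on_subsegments` (ties to `inf'_eq_of_gapTest`): with
`l 0 = fA` and a passing far vertex `fA ≤ l s₀`, the two-vertex box value `min (l 0) (l s)` is `fA`
on every sub-segment. [cite: BoydVandenberghe2004, §3.2.5] -/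
theorem box_eq_free_on_subsegments_of_concaveOn {l : ℝ → ℝ} {fA s₀ : ℝ}
    (hl : ConcaveOn ℝ (Set.Ici 0) l) (hfree : l 0 = fA) (hgap : fA ≤ l s₀) (_hs₀ : 0 ≤ s₀) :
    ∀ s, 0 ≤ s → s ≤ s₀ → min (l 0) (l s) = fA := by
  intro s hs hss
  have h := downClosed_of_concaveOn hl hfree.ge hgap hs hss
  rw [hfree]
  exact min_eq_left h

end Literature.Computation.Certificates.SharedVaryingBox
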